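/-
Origin: expansion seat `planner-pub-hodgecm-mc-sanity-1-0`, handover #2r 2026-08-18T18:55Z md5 86910e31f152b49463961e5db613cfe5 SUPERSEDES 4f945d344eef (doc-only; NEW additive leaf, 98 l.; imports HodgeCM.Model.Sanity.DegenerateCores only) (`HOME/mc/pub-hodgecm-mc-sanity-1/lean/SexticNonVacuity.lean`, md5 86910e31, 98 lines);
landed by the packager successor (mc-unitary-1-g3, gen-8 kit) in gate run 32 as `HodgeCM/Model/Sanity/SexticNonVacuity.lean` (verbatim).
-/
/-
HodgeCM / MODEL-CONSTRUCTION sub-cell (pub-hodgecm), node SAN — construction prover `pub-hodgecm-mc-sanity-1`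
(seat planner-pub-hodgecm-mc-sanity-1-0), 2026-08-18.  Intended PKG path: `HodgeCM/Model/Sanity/SexticNonVacuity.lean`.
Imports `Sanity/DegenerateCores.lean` (this seat) only; nothing restated, no new axioms, no hypotheses records, 0 proof holes.
-/
import Summits.HodgeConjecture.HodgeCM.Model.Sanity.DegenerateCores

/-!
# Sanity: the SEXTIC restriction of the E2 inputs is not vacuous

The E2 term (MODEL-DAG §2b/§2c; gen-1 `ThetaModelExists.lean` §5, RUN-32 queue) is
`U.ThetaModelExists_sextic = ∃ h (C : U.AdelicThetaCore₀) w12 w34,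
(C.thetaModelArch h w12 w34).AllCharsNonDesignOn (fun c => finrank ℚ c.K = 6)`: the five OPEN conjuncts C3–C7 are
demanded only at GOOD contexts whose type field `c.K` is sextic.  A restricted universal is content-free if its
domain is empty — so the sanity question is whether a SEXTIC good context provably exists.

It does, for EVERY theta model satisfying the two design constraints (`exists_goodCtx_sextic`: the face field
`ℚ(ζ₇)` of `Model/Inhabited.lean` IS sextic, `cyclo7_finrank`; hermitian space by `landherr_exists_proof`;
forced-sign seesaw datum by `exists_seesawDatum` with Landherr's lemma discharged, `lemma33bLandherr_holds`), hence
for every END STATE `C.thetaModel h d12 d34` / `C.thetaModelArch h w12 w34` (`exists_signRecipe_goodCtx_sextic`,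
model-free form over `SignRecipe.GoodCtx`).  Consequently the degenerate profiles of `DegenerateCores.lean` §3
persist under the sextic restriction: an empty-`Theta` core FAILS the sextic-restricted C4
(`not_thetaWedgeOn_sextic_of_emptyTheta`) — the E2 term cannot be witnessed by degenerate theta sets, exactly as
the unrestricted record.  (`AdelicThetaCore₀ = AdelicThetaCore printFact_unitaryCompact_holds` and
`thetaModelArch h w12 w34 = thetaModel h (side ∘ w12) (side ∘ w34)` are `abbrev`s, so every statement of
`DegenerateCores` / `Toy3Cores` / `OffRegimeRank` applies to the E2 interface by `rfl`.)
-/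

set_option autoImplicit false

noncomputable section

open HodgeCM HodgeCM.Universe

attribute [-instance] Quotient.instMeasurableSpace

namespace HodgeCM

namespace Universe.ThetaModel

variable {U : Universe} (T : U.ThetaModel)

/-- **A good context with SEXTIC type field exists** for every theta model satisfying the two design constraints
(cf. `exists_goodCtx''`, whose face field is the same `ℚ(ζ₇)` but whose statement forgets the degree). -/
theorem exists_goodCtx_sextic (hκ : T.Design_kappaConj) (hs : T.Design_frameSignConj) :
    ∃ (F : CMField) (ι₁ : F →+* ℂ) (_ : HermSpace3 F ι₁) (c : SeesawCtx F),
      T.GoodCtx ι₁ c ∧ Module.finrank ℚ c.K = 6 := by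
  obtain ⟨f, ι₁, hadm⟩ := exists_face_admissible cyclo7 (by rw [cyclo7_finrank])
  obtain ⟨V⟩ := landherr_exists_proof cyclo7 ι₁
  obtain ⟨D, hD⟩ := T.exists_seesawDatum hκ hs lemma33bLandherr_holds (RingHom.id cyclo7) ι₁ f.psi (pairSum_psi f)
  exact ⟨cyclo7, ι₁, V, ⟨cyclo7, f.psi, ι₁, D⟩, ⟨pairSum_psi f, StubTree.psi_injective cyclo7 f,
    admissible_mem_psi f ι₁ hadm, ⟨RingHom.id cyclo7, RingHom.comp_id ι₁, hD⟩⟩, cyclo7_finrank⟩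

end Universe.ThetaModel

namespace Universe.AdelicThetaCore

variable {U : Universe} {hP : PrintFact_unitaryCompact} (h : Bool)

/-- **A SEXTIC good context exists for every END STATE** (model-free, over `SignRecipe.GoodCtx`). -/
theorem exists_signRecipe_goodCtx_sextic (C : U.AdelicThetaCore hP)
    (d12 d34 : ∀ {L : CMField}, SeesawCtx L → SideData L) :
    ∃ (F : CMField) (ι₁ : F →+* ℂ) (_ : HermSpace3 F ι₁) (c : SeesawCtx F),
      SignRecipe.GoodCtx h ι₁ c ∧ Module.finrank ℚ c.K = 6 := by
  obtain ⟨F, ι₁, V, c, hc, h6⟩ := (C.thetaModel h d12 d34).exists_goodCtx_sextic (C.design_kappaConj h d12 d34)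
    (C.design_frameSignConj h d12 d34)
  exact ⟨F, ι₁, V, c, (C.thetaModel_goodCtx_iff h d12 d34 ι₁ c).mp hc, h6⟩

variable {C : U.AdelicThetaCore hP} (d12 d34 : ∀ {L : CMField}, SeesawCtx L → SideData L)

/-- **Empty theta sets FAIL the sextic-restricted C4** (the `thetaWedge` conjunct of `AllCharsNonDesignOn sextic`):
the E2 term `ThetaModelExists_sextic` is not degenerate-satisfiable. -/
theorem not_thetaWedgeOn_sextic_of_emptyTheta (hΘ : C.EmptyTheta) :
    ¬ ∀ {L : CMField} {ι₁ : L →+* ℂ} (V : HermSpace3 L ι₁) (c : SeesawCtx L),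
        (C.thetaModel h d12 d34).GoodCtx ι₁ c → Module.finrank ℚ c.K = 6 →
        ∃ Γ : Level V, ∃ ω₁ ∈ (C.thetaModel h d12 d34).Theta V c 0 Γ, ∃ ω₂ ∈ (C.thetaModel h d12 d34).Theta V c 1 Γ,
          U.cup2C (U.pms L ι₁ V Γ) 1 ω₁ ω₂ ≠ 0 := by
  intro H
  obtain ⟨F, ι₁, V, c, hc, h6⟩ := (C.thetaModel h d12 d34).exists_goodCtx_sextic (C.design_kappaConj h d12 d34)
    (C.design_frameSignConj h d12 d34)
  obtain ⟨Γ, ω₁, hω₁, -⟩ := H V c hc h6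
  have hΘ0 : (C.thetaModel h d12 d34).Theta V c 0 Γ = ∅ := hΘ V c 0 Γ
  rw [hΘ0] at hω₁
  exact hω₁

/-- … while the sextic-restricted C3 (`thetaSub`) and C5 (`thetaGen12All`) HOLD for empty theta sets, as
unrestricted (`DegenerateCores` §3) — restriction only weakens them. -/
theorem thetaSubOn_of_emptyTheta (hΘ : C.EmptyTheta) (S : ∀ {L : CMField}, SeesawCtx L → Prop) :
    ∀ {L : CMField} {ι₁ : L →+* ℂ} (V : HermSpace3 L ι₁) (c : SeesawCtx L),
      (C.thetaModel h d12 d34).GoodCtx ι₁ c → S c →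
      ∀ (i : Fin 4) (Γ : Level V), (C.thetaModel h d12 d34).Theta V c i Γ ⊆ U.Uiso Γ c.K (c.Ψ i) c.σ :=
  fun V c hc _ => open_thetaSub_of_emptyTheta h d12 d34 hΘ V c hc

end Universe.AdelicThetaCore

end HodgeCM

end
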